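import Literature.NumberTheory.NumberFields.GaloisPExtensionUnramifiedOutsidePCyclic
import Literature.NumberTheory.NumberFields.InertiaGeneratesGalois
import Literature.NumberTheory.EllipticCurves.ZpExtensionUnramifiedProofs
import Literature.NumberTheory.GaloisRepresentations.RestrictedRamificationUnramifiedSubfields
import HarnessLib

/-!
# `ℚ` is `p`-rational (`p` odd): an open normal subgroup of `Γ_ℚ` of `p`-power index containing the inertia
# groups away from `p` is a layer of the `ℤ_p`-extension (the maximal pro-`p` extension of `ℚ` unramified
# outside `{p, ∞}` is `ℚ_∞`)

`Proofs`-style file in topic `NumberTheory/IwasawaTheory` (namespace `Literature.NumberTheory.IwasawaTheory.RatPRational`):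
THEOREMS ONLY (no definition, no named fact, no instance, no `sorry`).  Written by the prover seat `bsd-eis-lam-a` g19
(cell `bsd-eis`, route `EisensteinPrimes`, crux 5 stmt-BirchSwinnertonDyer-19035 `MazurMCOnX1RankZero`; `--supports`
that item, closes nothing): the `Γ_ℚ`-dialect half of the kernel proof of the TRIVIAL-MODULE case of Greenberg's
Lemma 5.9 (LNM 1716; registered PUB stub `stub_publishedL59` of the line `interlude_with_torsion`), consumed by
`Literature/NumberTheory/IwasawaTheory/GreenbergCyclicOrderPTrivialProofs.lean`.

Let `p` be an odd prime, `κ : ZpExtension ℚ p` ANY `ℤ_p`-extension of `ℚ` (`ker κ = Gal(ℚ̄/ℚ_∞)`, layers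
`Λ_m = κ⁻¹(p^m ℤ_p) = Gal(ℚ̄/ℚ_m)`), and `N_S ≤ Γ_ℚ` the ramification subgroup outside `S = {v : p ∈ v}` (closed normal
subgroup generated by the inertia groups above the places `v ∤ p`, `RestrictedRamification.lean`).

* §1 `ramificationSubgroup_le_kerSubgroup` / `_le_layerSubgroup` — `N_S ≤ ker κ ≤ Λ_m` (a `ℤ_p`-extension is
  unramified outside `p`: `ZpExtension.inertia_le_kerSubgroup_holds`, Washington Prop. 13.2).
* §2 `isCyclic_quotient_of_isOpen_of_ramificationSubgroup_le` — an OPEN NORMAL `N ≤ Γ_ℚ` with `N_S ≤ N` and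
  `[Γ_ℚ : N] = p^t` has CYCLIC quotient: `ℚ̄^N` is a finite Galois `p`-extension of `ℚ` unramified outside `p`
  (dictionary `isUnramifiedAt_of_ramificationSubgroup_le_fixingSubgroup`, NSW VIII §3; the bridge
  `isUnramifiedAt_int_of_isUnramifiedAt_ringOfIntegers_rat` from `𝓞 ℚ` to `ℤ`), so the number-field theorem
  `NumberFields.isCyclic_of_isGalois_of_isUnramifiedAt_of_card_eq_prime_pow` (Marcus Ex. 34–36 + centre induction)
  applies; **`kerSubgroup_le_of_isPGroup_quotient`** — hence an open normal `N ⊇ N_S` with `Γ_ℚ/N` a `p`-group is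
  the layer `Λ_m`, `p^m = [Γ_ℚ : N]` (two subgroups of index `p^m` in the finite cyclic group `Γ_ℚ/(N ∩ Λ_m)`,
  `Subgroup.eq_of_index_eq_of_isCyclic`); in particular `ker κ ≤ N`.  This is the classical statement that `ℚ` is
  `p`-rational for odd `p`: `G_{ℚ,{p,∞}}(p) ≅ ℤ_p`.

Implementation note: Mathlib's number-field library synthesises `DivisionRing.toRatAlgebra` on the fixed field,
definitionally (not reducibly) equal to the structural `IntermediateField.algebra` of the `Γ_ℚ`-lemmas (cf. the note in
`KroneckerWeber_holds`); §2 re-types the `FiniteDimensional` / `IsGalois` instances once along this identification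
and passes the cyclicity instance explicitly.

HONEST FRAMING: textbook Galois/number theory; proves no case of BSD; no summit statement is proved.

## References

* L. C. Washington, *Introduction to Cyclotomic Fields*, 2nd ed. (1997), §13.1, Prop. 13.2. [Washington1997]
* D. A. Marcus, *Number Fields*, 2nd ed. (2018), Ch. 4, Ex. 34–36. [Marcus2018]
* J. Neukirch, A. Schmidt, K. Wingberg, *Cohomology of Number Fields*, 2nd ed. (2008), VIII §3; X §7
  (`ℚ_S(p)` for `S = {p, ∞}`). [NeukirchSchmidtWingberg2008]
* R. Greenberg, *Iwasawa theory for elliptic curves*, LNM 1716 (1999), §5 Lemma 5.9 (the consumer). [Greenberg1999LNM]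
-/

set_option autoImplicit false

noncomputable section

open scoped Classical Pointwise NumberField
open NumberField IsDedekindDomain Field IntermediateField

namespace Literature.NumberTheory.IwasawaTheory.RatPRational

open Literature.NumberTheory.EllipticCurves Literature.NumberTheory.GaloisRepresentations
  Literature.NumberTheory.NumberFields

variable {p : ℕ} [Fact p.Prime]

/-! ## §1 The ramification subgroup outside `p` lies in `ker κ` and in every layer -/

/-- **A `ℤ_p`-extension of `ℚ` is unramified outside `p`, in `N_S`-form**: the ramification subgroup of `Γ_ℚ`
outside `S = {v : p ∈ v}` (closed normal subgroup generated by the inertia groups `I_𝔓`, `𝔓` above `v ∤ p`)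
lies in `ker κ = Gal(ℚ̄/ℚ_∞)` — each such `I_𝔓` does (`ZpExtension.inertia_le_kerSubgroup_holds`), and
`ker κ` is closed and normal. [cite: Washington1997, §13.1 Prop. 13.2]
[cite: NeukirchSchmidtWingberg2008, VIII §3] -/
theorem ramificationSubgroup_le_kerSubgroup (κ : ZpExtension ℚ p) :
    ramificationSubgroup ℚ {v : HeightOneSpectrum (𝓞 ℚ) | ((p : ℕ) : 𝓞 ℚ) ∈ v.asIdeal} ≤ κ.kerSubgroup := by
  haveI : κ.kerSubgroup.Normal := by
    change κ.toContinuousMonoidHom.toMonoidHom.ker.Normal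
    infer_instance
  refine Subgroup.topologicalClosure_minimal _ ?_ κ.isClosed_kerSubgroup
  refine Subgroup.normalClosure_le_normal fun σ hσ => ?_
  rw [mem_inertiaOutside_iff] at hσ
  obtain ⟨v, hv, 𝔓, h𝔓, hσ⟩ := hσ
  exact ZpExtension.inertia_le_kerSubgroup_holds ℚ p κ hv h𝔓 hσ

/-- Hence `N_S ≤ Λ_m = Gal(ℚ̄/ℚ_m)` for every layer of the `ℤ_p`-extension. [cite: Washington1997, §13.1 Prop. 13.2] -/
theorem ramificationSubgroup_le_layerSubgroup (κ : ZpExtension ℚ p) (m : ℕ) :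
    ramificationSubgroup ℚ {v : HeightOneSpectrum (𝓞 ℚ) | ((p : ℕ) : 𝓞 ℚ) ∈ v.asIdeal} ≤ κ.layerSubgroup m :=
  (ramificationSubgroup_le_kerSubgroup κ).trans (κ.kerSubgroup_le_layerSubgroup m)

/-! ## §2 Open normal subgroups of `p`-power index above `N_S` are the layers («`ℚ` is `p`-rational») -/

/-- The restriction `Γ_ℚ → Gal(E/ℚ)` to a normal intermediate field of `ℚ̄/ℚ` is surjective (Mathlib
`AlgEquiv.restrictNormalHom_surjective`, transported through `Field.absoluteGaloisGroup.toAlgEquiv`; private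
copy of the tree's lemma of the same name). [folklore] -/
private theorem absRestrictNormalHom_surjective' {F : Type} [Field F]
    (E : IntermediateField F (AlgebraicClosure F)) [Normal F E] :
    Function.Surjective (absRestrictNormalHom (K := F) E) := fun τ => by
  obtain ⟨σ, hσ⟩ := AlgEquiv.restrictNormalHom_surjective (F := F) (K₁ := E)
    (E := AlgebraicClosure F) τ
  exact ⟨(absoluteGaloisGroup.toAlgEquiv F).symm σ, hσ⟩

/-- Bridge between the two base rings of `ℚ`: for a maximal ideal `Q` of the ring of integers of a Galois
number field, unramified over `𝓞 ℚ` implies unramified over `ℤ` (both ramification indices equal the order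
of the inertia group `I(Q) ≤ Gal(L/ℚ)`, `NumberFields.card_inertia_eq_ramificationIdx(_int)`; private helper). [folklore] -/
private theorem isUnramifiedAt_int_of_isUnramifiedAt_ringOfIntegers_rat {L : Type*} [Field L] [NumberField L]
    [IsGalois ℚ L] (Q : Ideal (𝓞 L)) [Q.IsMaximal] (h : Algebra.IsUnramifiedAt (𝓞 ℚ) Q) :
    Algebra.IsUnramifiedAt ℤ Q := by
  have hQ : Q.under ℤ ≠ ⊥ := Ideal.under_ne_bot ℤ (Ideal.IsMaximal.ne_bot_of_isIntegral_int Q)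
  haveI : Finite (ℤ ⧸ Q.under ℤ) := Ring.HasFiniteQuotients.finiteQuotient hQ
  have hQ' : Q.under (𝓞 ℚ) ≠ ⊥ := Ideal.under_ne_bot (𝓞 ℚ) (Ideal.IsMaximal.ne_bot_of_isIntegral_int Q)
  haveI : Finite (𝓞 ℚ ⧸ Q.under (𝓞 ℚ)) := Ring.HasFiniteQuotients.finiteQuotient hQ'
  rw [← Ideal.ramificationIdx_eq_one_iff, ← card_inertia_eq_ramificationIdx_int L (L ≃ₐ[ℚ] L) Q,
    card_inertia_eq_ramificationIdx L (L ≃ₐ[ℚ] L) ℚ Q, Ideal.ramificationIdx_eq_one_iff]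
  exact h

/-- **An open normal subgroup of `Γ_ℚ` of `p`-power index (`p` odd) containing the ramification subgroup
outside `p` has CYCLIC quotient.**  Its fixed field `L = ℚ̄^N` is a finite Galois extension of `ℚ` with
`Gal(L/ℚ) ≅ Γ_ℚ/N` of order `p^t` (Krull correspondence, `finrank_fixedField_of_isOpen`), unramified at every
prime `Q ∌ p` (`isUnramifiedAt_of_ramificationSubgroup_le_fixingSubgroup`), hence cyclic
(`NumberFields.isCyclic_of_isGalois_of_isUnramifiedAt_of_card_eq_prime_pow`).
[cite: Marcus2018, Ch. 4, Ex. 34–36 (pp. 102–103)] [cite: NeukirchSchmidtWingberg2008, VIII §3] -/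
theorem isCyclic_quotient_of_isOpen_of_ramificationSubgroup_le (hp2 : p ≠ 2)
    (N : Subgroup (absoluteGaloisGroup ℚ)) [hN : N.Normal] (hNo : IsOpen (N : Set (absoluteGaloisGroup ℚ)))
    (hNS : ramificationSubgroup ℚ {v : HeightOneSpectrum (𝓞 ℚ) | ((p : ℕ) : 𝓞 ℚ) ∈ v.asIdeal} ≤ N)
    {t : ℕ} (ht : N.index = p ^ t) : IsCyclic (absoluteGaloisGroup ℚ ⧸ N) := by
  have hpr : p.Prime := Fact.out
  have hfix : ((IntermediateField.fixedField N).fixingSubgroup : Subgroup (absoluteGaloisGroup ℚ)) = N :=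
    fixingSubgroup_fixedField_of_isOpen N hNo
  haveI hfd0 := finiteDimensional_fixedField_of_isOpen N hNo
  haveI hgal0 := (InfiniteGalois.normal_iff_isGalois (IntermediateField.fixedField N)).mp (by rw [hfix]; exact hN)
  /- The number-field library synthesises `DivisionRing.toRatAlgebra` on the fixed field, which agrees
  definitionally (not reducibly) with the structural `IntermediateField.algebra` used by the `Γ_ℚ`-lemmas
  (cf. `KroneckerWeber_holds`); we re-type the two instances once along this identification. -/
  haveI hfdR : FiniteDimensional ℚ (IntermediateField.fixedField N) := hfd0
  haveI hgalR : IsGalois ℚ (IntermediateField.fixedField N) := hgal0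
  haveI : NumberField (IntermediateField.fixedField N) := NumberField.mk
  have hfin : Module.finrank ℚ (IntermediateField.fixedField N) = N.index := finrank_fixedField_of_isOpen N hNo
  have hcardL : Nat.card ((IntermediateField.fixedField N) ≃ₐ[ℚ] (IntermediateField.fixedField N)) = p ^ t := by
    rw [IsGalois.card_aut_eq_finrank, hfin, ht]
  have hunr : ∀ (Q : Ideal (𝓞 (IntermediateField.fixedField N))) [Q.IsMaximal],
      (p : 𝓞 (IntermediateField.fixedField N)) ∉ Q → Algebra.IsUnramifiedAt ℤ Q := by
    intro Q _ hpQ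
    refine isUnramifiedAt_int_of_isUnramifiedAt_ringOfIntegers_rat Q ?_
    refine isUnramifiedAt_of_ramificationSubgroup_le_fixingSubgroup
      (S := {v : HeightOneSpectrum (𝓞 ℚ) | ((p : ℕ) : 𝓞 ℚ) ∈ v.asIdeal}) (IntermediateField.fixedField N)
      (by rw [hfix]; exact hNS) Q ?_
    rintro ⟨v, hv, hvQ⟩
    apply hpQ
    have h1 : ((p : ℕ) : 𝓞 ℚ) ∈ Q.under (𝓞 ℚ) := hvQ ▸ hv
    have h2 : algebraMap (𝓞 ℚ) (𝓞 (IntermediateField.fixedField N)) ((p : ℕ) : 𝓞 ℚ) ∈ Q :=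
      Ideal.mem_comap.mp h1
    rwa [map_natCast] at h2
  have hcyc : IsCyclic ((IntermediateField.fixedField N) ≃ₐ[ℚ] (IntermediateField.fixedField N)) :=
    isCyclic_of_isGalois_of_isUnramifiedAt_of_card_eq_prime_pow hpr hp2 hcardL hunr
  -- transport along `Γ_ℚ/N ≅ Gal(L/ℚ)`
  have hsurj := absRestrictNormalHom_surjective' (F := ℚ) (IntermediateField.fixedField N)
  have hker : (absRestrictNormalHom (K := ℚ) (IntermediateField.fixedField N)).ker = N := by
    rw [ker_absRestrictNormalHom_eq_fixingSubgroup, hfix]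
  let e := QuotientGroup.quotientKerEquivOfSurjective _ hsurj
  let e' : absoluteGaloisGroup ℚ ⧸ N ≃*
      absoluteGaloisGroup ℚ ⧸ (absRestrictNormalHom (K := ℚ) (IntermediateField.fixedField N)).ker :=
    QuotientGroup.quotientMulEquivOfEq hker.symm
  exact isCyclic_of_surjective (hH := hcyc) (e'.trans e).symm.toMonoidHom (e'.trans e).symm.surjective

/-- **`ℚ` is `p`-rational (`p` odd): an open normal subgroup `N ≤ Γ_ℚ` containing the ramification subgroup
outside `p` with `Γ_ℚ/N` a `p`-GROUP contains `ker κ`** — indeed `N` is the layer `Λ_m`, `p^m = [Γ_ℚ : N]`: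
`N' = N ∩ Λ_m` is again open, normal, above `N_S` and of `p`-power index, so `Γ_ℚ/N'` is cyclic by
`isCyclic_quotient_of_isOpen_of_ramificationSubgroup_le`, and `N/N'`, `Λ_m/N'` are subgroups of the same
index `p^m` of a finite cyclic group, hence equal (`Subgroup.eq_of_index_eq_of_isCyclic`).  Equivalently: the
maximal pro-`p` extension of `ℚ` unramified outside `{p, ∞}` is `ℚ_∞`. [cite: Washington1997, §13.1 Prop. 13.2]
[cite: NeukirchSchmidtWingberg2008, VIII §3] [cite: Marcus2018, Ch. 4, Ex. 34–36 (pp. 102–103)] -/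
theorem kerSubgroup_le_of_isPGroup_quotient (hp2 : p ≠ 2) (κ : ZpExtension ℚ p)
    (N : Subgroup (absoluteGaloisGroup ℚ)) [N.Normal] (hNo : IsOpen (N : Set (absoluteGaloisGroup ℚ)))
    (hNS : ramificationSubgroup ℚ {v : HeightOneSpectrum (𝓞 ℚ) | ((p : ℕ) : 𝓞 ℚ) ∈ v.asIdeal} ≤ N)
    (hNP : IsPGroup p (absoluteGaloisGroup ℚ ⧸ N)) : κ.kerSubgroup ≤ N := by
  have hpr : p.Prime := Fact.out
  haveI : Finite (absoluteGaloisGroup ℚ ⧸ N) := Subgroup.quotient_finite_of_isOpen _ hNo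
  obtain ⟨m, hm⟩ := IsPGroup.iff_card.mp hNP
  have hidx : N.index = p ^ m := by rw [Subgroup.index_eq_card]; exact hm
  set Λ : Subgroup (absoluteGaloisGroup ℚ) := κ.layerSubgroup m with hΛ
  have hΛidx : Λ.index = p ^ m := κ.index_layerSubgroup m
  set N' : Subgroup (absoluteGaloisGroup ℚ) := N ⊓ Λ with hN'
  haveI : N'.Normal := Subgroup.normal_inf_normal N Λ
  have hN'o : IsOpen (N' : Set (absoluteGaloisGroup ℚ)) := by
    rw [hN', Subgroup.coe_inf]
    exact hNo.inter (κ.isOpen_layerSubgroup m)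
  have hN'S : ramificationSubgroup ℚ {v : HeightOneSpectrum (𝓞 ℚ) | ((p : ℕ) : 𝓞 ℚ) ∈ v.asIdeal} ≤ N' :=
    le_inf hNS (ramificationSubgroup_le_layerSubgroup κ m)
  -- `Γ/N'` is a `p`-group
  have hN'P : IsPGroup p (absoluteGaloisGroup ℚ ⧸ N') := by
    intro q
    induction q using QuotientGroup.induction_on with
    | H g =>
      obtain ⟨a, ha⟩ := hNP (g : absoluteGaloisGroup ℚ ⧸ N)
      rw [← QuotientGroup.mk_pow, QuotientGroup.eq_one_iff] at ha
      have hgΛ : g ^ p ^ m ∈ Λ := by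
        rw [← hΛidx]
        exact Subgroup.pow_index_mem Λ g
      refine ⟨a + m, ?_⟩
      rw [← QuotientGroup.mk_pow, QuotientGroup.eq_one_iff, hN']
      refine Subgroup.mem_inf.2 ⟨?_, ?_⟩
      · rw [pow_add, pow_mul]
        exact N.pow_mem ha _
      · rw [pow_add, pow_mul']
        exact Λ.pow_mem hgΛ _
  haveI : Finite (absoluteGaloisGroup ℚ ⧸ N') := Subgroup.quotient_finite_of_isOpen _ hN'o
  obtain ⟨t, ht⟩ := IsPGroup.iff_card.mp hN'P
  have hcyc : IsCyclic (absoluteGaloisGroup ℚ ⧸ N') :=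
    isCyclic_quotient_of_isOpen_of_ramificationSubgroup_le hp2 N' hN'o hN'S
      (t := t) (by rw [Subgroup.index_eq_card]; exact ht)
  -- the images of `N` and `Λ` in the cyclic group `Γ/N'` have the same index, hence coincide
  set π : absoluteGaloisGroup ℚ →* absoluteGaloisGroup ℚ ⧸ N' := QuotientGroup.mk' N' with hπ
  have hπs : Function.Surjective π := QuotientGroup.mk'_surjective N'
  have hkerπ : π.ker = N' := QuotientGroup.ker_mk' N'
  have hcA : (N.map π).comap π = N := by
    rw [Subgroup.comap_map_eq, hkerπ, hN']
    exact sup_eq_left.mpr inf_le_left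
  have hcB : (Λ.map π).comap π = Λ := by
    rw [Subgroup.comap_map_eq, hkerπ, hN']
    exact sup_eq_left.mpr inf_le_right
  have hiA : (N.map π).index = p ^ m := by
    have h := Subgroup.index_comap_of_surjective (H := N.map π) hπs
    rw [hcA, hidx] at h
    exact h.symm
  have hiB : (Λ.map π).index = p ^ m := by
    have h := Subgroup.index_comap_of_surjective (H := Λ.map π) hπs
    rw [hcB, hΛidx] at h
    exact h.symm
  letI : CommGroup (absoluteGaloisGroup ℚ ⧸ N') := IsCyclic.commGroup
  have hAB : N.map π = Λ.map π := Subgroup.eq_of_index_eq_of_isCyclic (by rw [hiA, hiB])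
  have hNΛ : N = Λ := by rw [← hcA, ← hcB, hAB]
  rw [hNΛ]
  exact κ.kerSubgroup_le_layerSubgroup m

end Literature.NumberTheory.IwasawaTheory.RatPRational

end
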